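import Mathlib
import HarnessLib
import Literature.NumberTheory.LFunctions.ZetaSubconvexity
import Literature.NumberTheory.LFunctions.BourgainTheorem4SixthMoment

/-!
# The sixth moment of the `h`-sums with a fifth coordinate `h^{-1/2}` (PROVED)

Topic `Literature/NumberTheory/LFunctions`. A companion of `BourgainTheorem4SixthMoment.lean`
(J. Bourgain, *Decoupling, exponential sums and the Riemann zeta function*, J. AMS 30 (2017), §4,
(3.7)–(3.10), (3.14)) for the arcs `q < R` of the Huxley–Watt reduction, where the expansion
`(h - τ)^{3/2} = h^{3/2} - (3/2)τh^{1/2} + (3/8)τ²h^{-1/2} + O(τ³h^{-3/2})` must be carried one term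
further (the coefficient of `h^{-1/2}` is `≍ (R/q)² ≫ 1` there, too large for partial summation) and
where Bourgain's `X₃ = (R/Q)²H^{1/2}` exceeds `H^{1/2}`:

* `hsum5 H α x = ∑_{h ≤ H} αʰ e(x · (h, h², h^{3/2}, h^{1/2}, h^{-1/2}))`, boxes
  `X = (1/2, 1/2, X₃, X₃, X₅)`, `Y = (6H, 6H²V, 6H^{3/2}, 6H^{1/2}, 6)`;
* `eq38V5`: the Bombieri–Iwaniec double large sieve (`DoubleLargeSieve.doubleLargeSieve_count`, any
  number of coordinates) gives `(∑_I |hsum5|⁶)² ≤ 624⁵ ∏_{j<5}(1 + 4X_jY_j) · B_V · A`, where both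
  neighbour counts are bounded by DROPPING the fifth condition: `A ≤` Bourgain's first spacing count
  `bourgainFirstSpacingCount H δ (Hδ)`, `δ = 1/(X₃H^{3/2})`, and `B_V ≤` Bourgain's
  `bourgainSecondSpacingCount` of the projected (four-coordinate) family (`proj4`);
* `bourgainFirstSpacingCount_mono`: the first spacing count is monotone in `(δ, Δ)`, so for
  `X₃ > H^{1/2}` (`δ < 1/H²`, outside Corollary 3) it is bounded by its value at `δ = 1/H²`;
* `sixthMoment5_of_corollary3`: assuming Corollary 3,
  `∑_I |hsum5|⁶ ≤ C(ε) (1 + 24X₅)^{1/2} max(1, X₃H^{-1/2}) H^{6+ε} (V B_V)^{1/2}` for `X₃ ≥ H^{-1/2}`,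
  `X₅ > 0`, `V ≥ 1` — Bourgain's bound with the extra box factor `(1 + X₅Y₅)^{1/2}` and, above
  `H^{1/2}`, the factor `X₃H^{-1/2}` from `∏(X_jY_j + 1)`.

Everything is PROVED; no named fact is introduced.

## References

* J. Bourgain, *Decoupling, exponential sums and the Riemann zeta function*, J. Amer. Math. Soc. 30
  (2017), 205–224 — §4, (3.7)–(3.10), (3.14). [BourgainJAMS2017]
* E. Bombieri, H. Iwaniec, *On the order of ζ(1/2 + it)*, Ann. Sc. Norm. Sup. Pisa 13 (1986),
  449–472 — Lemma 2.4. [BombieriIwaniec1986]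
* M. N. Huxley, N. Watt, *Exponential sums and the Riemann zeta function*, Proc. London Math. Soc.
  (3) 57 (1988), 1–24 — §4, Step 4. [HuxleyWatt1988]
-/

noncomputable section

open Complex Finset MeasureTheory
open scoped Real

namespace Literature.NumberTheory.LFunctions

open DoubleLargeSieve (closePairs doubleLargeSieve_count e_sum)
open VdC (e norm_e e_add)

/-! ## Five coordinates: `(h, h², h^{3/2}, h^{1/2}, h^{-1/2})` -/

/-- The monomial vector `(h, h², h^{3/2}, h^{1/2}, h^{-1/2}) ∈ ℝ⁵` (Bourgain's four monomials and the
next term `h^{-1/2}` of the expansion of `(h - τ)^{3/2}`, kept for the arcs `q < R`). [folklore] -/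
def mono5 (h : ℕ) : Fin 5 → ℝ :=
  ![(h : ℝ), (h : ℝ) ^ 2, (h : ℝ) ^ (3 / 2 : ℝ), (h : ℝ) ^ (1 / 2 : ℝ), (h : ℝ) ^ (-(1 / 2) : ℝ)]

/-- `y(𝐡) = ∑_{j ≤ 6} mono5(h_j) ∈ ℝ⁵`. [folklore] -/
def yvec5 (w : Fin 6 → ℕ) : Fin 5 → ℝ := fun k => ∑ j, mono5 (w j) k

/-- Box sizes `(1/2, 1/2, X₃, X₃, X₅)`. [folklore] -/
def xbound5 (X₃ X₅ : ℝ) : Fin 5 → ℝ := ![1 / 2, 1 / 2, X₃, X₃, X₅]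

/-- Box sizes `(6H, 6H²V, 6H^{3/2}, 6H^{1/2}, 6)`. [folklore] -/
def ybound5 (H : ℕ) (V : ℝ) : Fin 5 → ℝ :=
  ![6 * (H : ℝ), 6 * (H : ℝ) ^ 2 * V, 6 * (H : ℝ) ^ (3 / 2 : ℝ), 6 * (H : ℝ) ^ (1 / 2 : ℝ), 6]

/-- The five-coordinate `h`-sum `∑_{1 ≤ h ≤ H} αʰ e(x · mono5(h))`. [folklore] -/
def hsum5 (H : ℕ) (α : ℂ) (x : Fin 5 → ℝ) : ℂ :=
  ∑ h ∈ Finset.Icc 1 H, α ^ h * e (∑ k, x k * mono5 h k)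

/-- Projection to the first four coordinates. [folklore] -/
def proj4 (x : Fin 5 → ℝ) : Fin 4 → ℝ := fun k => x (Fin.castSucc k)

/-- The first four coordinates of `mono5` are Bourgain's monomials. [folklore] -/
theorem mono5_castSucc (h : ℕ) (k : Fin 4) : mono5 h (Fin.castSucc k) = bourgainMonomials h k := by
  fin_cases k <;> rfl

/-- The first four box sizes are Bourgain's. [folklore] -/
theorem xbound5_castSucc (X₃ X₅ : ℝ) (k : Fin 4) : xbound5 X₃ X₅ (Fin.castSucc k) = bourgainXBound X₃ k := by
  fin_cases k <;> rfl

/-- The first four box sizes are Bourgain's. [folklore] -/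
theorem ybound5_castSucc (H : ℕ) (V : ℝ) (k : Fin 4) : ybound5 H V (Fin.castSucc k) = bourgainYBound H V k := by
  fin_cases k <;> rfl

/-- The fifth monomial `h^{-1/2} ∈ [0, 1]` for `h ≥ 1`. [folklore] -/
theorem mono5_four_mem {h : ℕ} (hh : 1 ≤ h) : 0 ≤ mono5 h 4 ∧ mono5 h 4 ≤ 1 := by
  have hR : (1 : ℝ) ≤ h := by exact_mod_cast hh
  show 0 ≤ (h : ℝ) ^ (-(1 / 2) : ℝ) ∧ (h : ℝ) ^ (-(1 / 2) : ℝ) ≤ 1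
  exact ⟨by positivity, Real.rpow_le_one_of_one_le_of_nonpos hR (by norm_num)⟩

/-- `|y_j(𝐡)| ≤ Y_j` for `𝐡 ∈ [1, H]⁶`, `V = 1`. [folklore] -/
theorem abs_yvec5_le {H : ℕ} {w : Fin 6 → ℕ}
    (hw : w ∈ Fintype.piFinset fun _ : Fin 6 => Finset.Icc 1 H) (k : Fin 5) :
    |yvec5 w k| ≤ ybound5 H 1 k := by
  induction k using Fin.lastCases with
  | last =>
    show |∑ j, mono5 (w j) 4| ≤ 6
    have hj : ∀ j, 1 ≤ w j := fun j => (Finset.mem_Icc.1 (Fintype.mem_piFinset.1 hw j)).1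
    rw [abs_of_nonneg (Finset.sum_nonneg fun j _ => (mono5_four_mem (hj j)).1)]
    calc ∑ j, mono5 (w j) 4 ≤ ∑ _j : Fin 6, (1 : ℝ) := Finset.sum_le_sum fun j _ => (mono5_four_mem (hj j)).2
      _ = 6 := by simp
  | cast k =>
    rw [ybound5_castSucc]
    have : yvec5 w (Fin.castSucc k) = bourgainYVec w k := by
      simp only [yvec5, bourgainYVec, mono5_castSucc]
    rw [this]
    exact abs_bourgainYVec_le hw k

/-- `Y_{1,j} ≤ Y_{V,j}`. [folklore] -/
theorem ybound5_one_le {H : ℕ} {V : ℝ} (hV : 1 ≤ V) (k : Fin 5) : ybound5 H 1 k ≤ ybound5 H V k := by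
  induction k using Fin.lastCases with
  | last => exact le_rfl
  | cast k => rw [ybound5_castSucc, ybound5_castSucc]; exact bourgainYBound_one_le hV k

/-- `Y_{V,j} > 0`. [folklore] -/
theorem ybound5_pos {H : ℕ} (hH : 1 ≤ H) {V : ℝ} (hV : 0 < V) (k : Fin 5) : 0 < ybound5 H V k := by
  induction k using Fin.lastCases with
  | last => show (0 : ℝ) < 6; norm_num
  | cast k => rw [ybound5_castSucc]; exact bourgainYBound_pos hH hV k

/-- `X_j > 0`. [folklore] -/
theorem xbound5_pos {X₃ X₅ : ℝ} (hX₃ : 0 < X₃) (hX₅ : 0 < X₅) (k : Fin 5) : 0 < xbound5 X₃ X₅ k := by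
  induction k using Fin.lastCases with
  | last => exact hX₅
  | cast k => rw [xbound5_castSucc]; exact bourgainXBound_pos hX₃ k

/-- Expansion of the sixth power over six-tuples. [folklore] -/
theorem hsum5_pow_six (H : ℕ) (α : ℂ) (x : Fin 5 → ℝ) :
    hsum5 H α x ^ 6 =
      ∑ w ∈ Fintype.piFinset (fun _ : Fin 6 => Finset.Icc 1 H),
        α ^ (∑ j, w j) * e (∑ k, x k * yvec5 w k) := by
  unfold hsum5
  have h6 : (∑ h ∈ Finset.Icc 1 H, α ^ h * e (∑ k, x k * mono5 h k)) ^ 6 =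
      ∏ _j : Fin 6, ∑ h ∈ Finset.Icc 1 H, α ^ h * e (∑ k, x k * mono5 h k) := by
    rw [Finset.prod_const, Finset.card_univ, Fintype.card_fin]
  rw [h6, Finset.prod_univ_sum (fun _ : Fin 6 => Finset.Icc 1 H)
    (fun _ h => α ^ h * e (∑ k, x k * mono5 h k))]
  refine Finset.sum_congr rfl fun w _ => ?_
  rw [Finset.prod_mul_distrib, Finset.prod_pow_eq_pow_sum, ← e_sum]
  have hsum : ∑ j, ∑ k, x k * mono5 (w j) k = ∑ k, x k * yvec5 w k := by
    rw [Finset.sum_comm]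
    simp only [yvec5, Finset.mul_sum]
  rw [hsum]

/-- Dropping the fifth condition: the second spacing count of the five-coordinate family is at most
Bourgain's `B_V` of the projected family. [folklore] -/
theorem closePairs5_le_secondSpacingCount (𝓘 : Finset ℕ) (x : ℕ → Fin 5 → ℝ) {H : ℕ} (hH : 1 ≤ H)
    {V : ℝ} (hV : 0 < V) :
    closePairs 𝓘 x (fun k => (2 * (2 * ybound5 H V k))⁻¹) ≤
      bourgainSecondSpacingCount 𝓘 (fun I => proj4 (x I)) H V := by
  unfold bourgainSecondSpacingCount
  refine closePairs_le_card_filter 𝓘 x _ _ fun p _ hp k => ?_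
  have h := hp (Fin.castSucc k)
  rw [ybound5_castSucc] at h
  have hY := bourgainYBound_pos hH hV k
  refine lt_of_le_of_lt h ?_
  rw [inv_lt_inv₀ (by positivity) (by positivity)]
  linarith

/-- Dropping the fifth condition: the first spacing count of the five-coordinate six-tuples is at most
Bourgain's `A(δ, Hδ)`, `δ = 1/(X₃H^{3/2})`. [folklore] -/
theorem closePairs5_le_firstSpacingCount {H : ℕ} (hH : 1 ≤ H) {X₃ : ℝ} (X₅ : ℝ) (hX₃ : 0 < X₃) :
    closePairs (Fintype.piFinset fun _ : Fin 6 => Finset.Icc 1 H) yvec5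
        (fun k => (2 * (2 * xbound5 X₃ X₅ k))⁻¹) ≤
      bourgainFirstSpacingCount H (1 / (X₃ * (H : ℝ) ^ (3 / 2 : ℝ)))
        (H * (1 / (X₃ * (H : ℝ) ^ (3 / 2 : ℝ)))) := by
  classical
  refine le_trans ?_ (closePairs_le_bourgainFirstSpacingCount hH hX₃)
  unfold DoubleLargeSieve.closePairs
  refine Finset.card_le_card fun p hp => ?_
  have hp' := (@Finset.mem_filter _ _ (_) _ _).1 hp
  refine (@Finset.mem_filter _ _ (_) _ _).2 ⟨hp'.1, fun k => ?_⟩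
  have h : |yvec5 p.1 (Fin.castSucc k) - yvec5 p.2 (Fin.castSucc k)| ≤
      (2 * (2 * xbound5 X₃ X₅ (Fin.castSucc k)))⁻¹ := hp'.2 (Fin.castSucc k)
  rw [xbound5_castSucc] at h
  have : bourgainYVec p.1 k - bourgainYVec p.2 k = yvec5 p.1 (Fin.castSucc k) - yvec5 p.2 (Fin.castSucc k) := by
    simp only [yvec5, bourgainYVec, mono5_castSucc]
  show |bourgainYVec p.1 k - bourgainYVec p.2 k| ≤ (2 * (2 * bourgainXBound X₃ k))⁻¹
  rw [this]
  exact h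

/-- **The double large sieve for the five-coordinate family** ((3.8) with one more coordinate):
`(∑_I |hsum5|⁶)² ≤ 624⁵ ∏_{j<5}(1 + 4X_jY_{V,j}) · B_V(proj) · A(δ, Hδ)`.
[cite: BourgainJAMS2017, §4 eqs. (3.7)–(3.9)] [cite: BombieriIwaniec1986, Lemma 2.4] -/
theorem eq38V5 {H : ℕ} (hH : 1 ≤ H) {X₃ X₅ : ℝ} (hX₃ : 0 < X₃) (hX₅ : 0 < X₅) {V : ℝ} (hV : 1 ≤ V)
    (𝓘 : Finset ℕ) (x : ℕ → Fin 5 → ℝ) (hx : ∀ I ∈ 𝓘, ∀ k, |x I k| ≤ xbound5 X₃ X₅ k)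
    (α : ℂ) (hα : ‖α‖ ≤ 1) :
    (∑ I ∈ 𝓘, ‖hsum5 H α (x I)‖ ^ 6) ^ 2 ≤
      624 ^ 5 * (∏ k, (1 + 2 * xbound5 X₃ X₅ k * (2 * ybound5 H V k))) *
        (bourgainSecondSpacingCount 𝓘 (fun I => proj4 (x I)) H V : ℝ) *
        (bourgainFirstSpacingCount H (1 / (X₃ * (H : ℝ) ^ (3 / 2 : ℝ)))
          (H * (1 / (X₃ * (H : ℝ) ^ (3 / 2 : ℝ)))) : ℝ) := by
  classical
  set sY := Fintype.piFinset fun _ : Fin 6 => Finset.Icc 1 H with hsY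
  set b : (Fin 6 → ℕ) → ℂ := fun w => α ^ (∑ j, w j) with hb
  set X' : Fin 5 → ℝ := fun k => 2 * xbound5 X₃ X₅ k with hX'
  set Y' : Fin 5 → ℝ := fun k => 2 * ybound5 H V k with hY'
  have hV0 : 0 < V := by linarith
  obtain ⟨ω, hω, hsum⟩ := exists_unimodular_sum_norm_eq 𝓘 (fun I => hsum5 H α (x I) ^ 6)
  have hbil : (((∑ I ∈ 𝓘, ‖hsum5 H α (x I)‖ ^ 6 : ℝ)) : ℂ) =
      ∑ I ∈ 𝓘, ∑ w ∈ sY, ω I * b w * e (∑ k, x I k * yvec5 w k) := by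
    have h1 : (∑ I ∈ 𝓘, ‖hsum5 H α (x I)‖ ^ 6) = ∑ I ∈ 𝓘, ‖hsum5 H α (x I) ^ 6‖ := by
      simp_rw [norm_pow]
    rw [h1, hsum]
    refine Finset.sum_congr rfl fun I _ => ?_
    rw [hsum5_pow_six, Finset.mul_sum]
    refine Finset.sum_congr rfl fun w _ => ?_
    simp only [hb]
    ring
  have hXpos : ∀ k, 0 < X' k := fun k => mul_pos two_pos (xbound5_pos hX₃ hX₅ k)
  have hYpos : ∀ k, 0 < Y' k := fun k => mul_pos two_pos (ybound5_pos hH hV0 k)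
  have hx' : ∀ I ∈ 𝓘, ∀ k, |x I k| ≤ X' k := fun I hI k =>
    (hx I hI k).trans (by simp only [hX']; linarith [xbound5_pos hX₃ hX₅ k])
  have hy' : ∀ w ∈ sY, ∀ k, |yvec5 w k| ≤ Y' k := fun w hw k =>
    ((abs_yvec5_le hw k).trans (ybound5_one_le hV k)).trans
      (by simp only [hY']; linarith [ybound5_pos hH hV0 k])
  have hbn : ∀ w ∈ sY, ‖b w‖ ≤ 1 := fun w _ => by
    simp only [hb, norm_pow]
    exact pow_le_one₀ (norm_nonneg _) hα
  have hDLS := doubleLargeSieve_count 𝓘 sY x yvec5 ω b X' Y' hXpos hYpos hx' hy' (fun I _ => hω I) hbn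
  have hL : ‖∑ I ∈ 𝓘, ∑ w ∈ sY, ω I * b w * e (∑ k, x I k * yvec5 w k)‖ ^ 2 =
      (∑ I ∈ 𝓘, ‖hsum5 H α (x I)‖ ^ 6) ^ 2 := by
    rw [← hbil, Complex.norm_real, Real.norm_eq_abs,
      abs_of_nonneg (Finset.sum_nonneg fun _ _ => by positivity)]
  rw [hL, Fintype.card_fin] at hDLS
  refine hDLS.trans ?_
  have hB : (closePairs 𝓘 x (fun k => (2 * Y' k)⁻¹) : ℝ) ≤
      bourgainSecondSpacingCount 𝓘 (fun I => proj4 (x I)) H V := by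
    exact_mod_cast closePairs5_le_secondSpacingCount 𝓘 x hH hV0
  have hA : (closePairs sY yvec5 (fun k => (2 * X' k)⁻¹) : ℝ) ≤
      bourgainFirstSpacingCount H (1 / (X₃ * (H : ℝ) ^ (3 / 2 : ℝ)))
        (H * (1 / (X₃ * (H : ℝ) ^ (3 / 2 : ℝ)))) := by
    exact_mod_cast closePairs5_le_firstSpacingCount hH X₅ hX₃
  have h0 : (0 : ℝ) ≤ 624 ^ 5 * ∏ k, (1 + X' k * Y' k) :=
    mul_nonneg (by positivity) (Finset.prod_nonneg fun k _ => by nlinarith [hXpos k, hYpos k])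
  have hprod : ∏ k, (1 + X' k * Y' k) = ∏ k, (1 + 2 * xbound5 X₃ X₅ k * (2 * ybound5 H V k)) :=
    Finset.prod_congr rfl fun k _ => by simp only [hX', hY']
  calc (624 : ℝ) ^ 5 * (∏ k, (1 + X' k * Y' k)) *
        (closePairs 𝓘 x (fun k => (2 * Y' k)⁻¹) : ℝ) * (closePairs sY yvec5 (fun k => (2 * X' k)⁻¹) : ℝ)
      ≤ 624 ^ 5 * (∏ k, (1 + X' k * Y' k)) *
          (bourgainSecondSpacingCount 𝓘 (fun I => proj4 (x I)) H V : ℝ) *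
          (closePairs sY yvec5 (fun k => (2 * X' k)⁻¹) : ℝ) :=
        mul_le_mul_of_nonneg_right (mul_le_mul_of_nonneg_left hB h0) (Nat.cast_nonneg _)
    _ ≤ 624 ^ 5 * (∏ k, (1 + X' k * Y' k)) *
          (bourgainSecondSpacingCount 𝓘 (fun I => proj4 (x I)) H V : ℝ) *
          (bourgainFirstSpacingCount H (1 / (X₃ * (H : ℝ) ^ (3 / 2 : ℝ)))
            (H * (1 / (X₃ * (H : ℝ) ^ (3 / 2 : ℝ)))) : ℝ) :=
        mul_le_mul_of_nonneg_left hA (mul_nonneg h0 (Nat.cast_nonneg _))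
    _ = _ := by rw [hprod]

/-- The five box factors: the first four are Bourgain's, the fifth is `1 + 24X₅`. [folklore] -/
theorem prod_boxFactors5 (H : ℕ) (X₃ X₅ V : ℝ) :
    ∏ k, (1 + 2 * xbound5 X₃ X₅ k * (2 * ybound5 H V k)) =
      (∏ k, (1 + 2 * bourgainXBound X₃ k * (2 * bourgainYBound H V k))) * (1 + 24 * X₅) := by
  rw [Fin.prod_univ_castSucc]
  have h1 : ∏ i : Fin 4, (1 + 2 * xbound5 X₃ X₅ (Fin.castSucc i) * (2 * ybound5 H V (Fin.castSucc i))) =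
      ∏ k, (1 + 2 * bourgainXBound X₃ k * (2 * bourgainYBound H V k)) :=
    Finset.prod_congr rfl fun k _ => by rw [xbound5_castSucc, ybound5_castSucc]
  have h2 : (1 + 2 * xbound5 X₃ X₅ (Fin.last 4) * (2 * ybound5 H V (Fin.last 4))) = 1 + 24 * X₅ := by
    show 1 + 2 * X₅ * (2 * 6) = 1 + 24 * X₅; ring
  rw [h1, h2]

/-- **Monotonicity of the first spacing count** in the tolerances. [folklore] -/
theorem bourgainFirstSpacingCount_mono (H : ℕ) {δ δ' Δ Δ' : ℝ} (hδ : δ ≤ δ') (hΔ : Δ ≤ Δ') :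
    bourgainFirstSpacingCount H δ Δ ≤ bourgainFirstSpacingCount H δ' Δ' := by
  unfold bourgainFirstSpacingCount
  refine Finset.card_le_card fun p hp => ?_
  rw [Finset.mem_filter] at hp ⊢
  obtain ⟨hm, h1, h2, h3, h4⟩ := hp
  exact ⟨hm, h1, h2, h3.trans_le (by linarith), h4.trans_le (by linarith)⟩


/-- **Sixth moment of the five-coordinate `h`-sums from Corollary 3** (the analogue of
`Bourgain2017_sixthMoment_of_corollary3` with the extra coordinate `h^{-1/2}` and without the upper
restriction `X₃ ≤ H^{1/2}`): assuming Corollary 3 (`hC3`), for every `ε > 0` there is `C` with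
`∑_I |hsum5 H α (x I)|⁶ ≤ C (1 + 24X₅)^{1/2} max(1, X₃H^{-1/2}) H^{6+ε} (V B_V)^{1/2}` for `H ≥ 1`,
`X₃ ≥ H^{-1/2}`, `X₅ > 0`, `V ≥ 1`, `|x₁|,|x₂| ≤ 1/2`, `|x₃|,|x₄| ≤ X₃`, `|x₅| ≤ X₅`, `|α| ≤ 1`, where
`B_V` is Bourgain's second spacing count of the first four coordinates. For `X₃ > H^{1/2}` the first
spacing count is estimated by monotonicity at `δ = 1/H²` (so only the box factor `X₃²` is lost).
[cite: BourgainJAMS2017, §4 eqs. (3.8), (3.10), (3.14)] -/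
theorem sixthMoment5_of_corollary3
    (hC3 : ∀ ε : ℝ, 0 < ε → ∃ C : ℝ, ∀ N : ℕ, 1 ≤ N → ∀ δ Δ : ℝ,
      1 / (N : ℝ) ^ 2 ≤ δ → δ ≤ 1 → 1 / (N : ℝ) ≤ Δ → Δ ≤ 1 →
        bourgainA6 N δ Δ ≤ C * δ * Δ * (N : ℝ) ^ (9 + ε))
    {ε : ℝ} (hε : 0 < ε) :
    ∃ C : ℝ, ∀ H : ℕ, 1 ≤ H → ∀ X₃ : ℝ, (H : ℝ) ^ (-(1 / 2 : ℝ)) ≤ X₃ → ∀ X₅ : ℝ, 0 < X₅ →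
      ∀ V : ℝ, 1 ≤ V → ∀ (𝓘 : Finset ℕ) (x : ℕ → Fin 5 → ℝ),
        (∀ I ∈ 𝓘, ∀ k, |x I k| ≤ xbound5 X₃ X₅ k) → ∀ α : ℂ, ‖α‖ ≤ 1 →
          ∑ I ∈ 𝓘, ‖hsum5 H α (x I)‖ ^ 6 ≤
            C * Real.sqrt (1 + 24 * X₅) * max 1 (X₃ / (H : ℝ) ^ (1 / 2 : ℝ)) * (H : ℝ) ^ (6 + ε) *
              Real.sqrt (V * bourgainSecondSpacingCount 𝓘 (fun I => proj4 (x I)) H V) := by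
  obtain ⟨CA, hCA⟩ := Bourgain2017_eq310_count_of_corollary3 hC3 (show 0 < 2 * ε by linarith)
  set C₀ : ℝ := 624 ^ 5 * 105625 * max CA 0 with hC₀
  have hC₀0 : 0 ≤ C₀ := by positivity
  refine ⟨Real.sqrt C₀, ?_⟩
  intro H hH X₃ hXl X₅ hX₅ V hV 𝓘 x hx α hα
  have hHpos : (0 : ℝ) < H := by exact_mod_cast hH
  have hH1 : (1 : ℝ) ≤ H := by exact_mod_cast hH
  have hV0 : 0 < V := by linarith
  set s : ℝ := (H : ℝ) ^ (1 / 2 : ℝ) with hs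
  have hspos : 0 < s := by positivity
  have hs1 : 1 ≤ s := Real.one_le_rpow hH1 (by norm_num)
  have hs2 : s ^ 2 = H := by
    rw [hs, ← Real.rpow_natCast, ← Real.rpow_mul hHpos.le]; norm_num
  have hm12 : (H : ℝ) ^ (-(1 / 2 : ℝ)) = s⁻¹ := Real.rpow_neg hHpos.le _
  rw [hm12] at hXl
  have hX₃pos : 0 < X₃ := lt_of_lt_of_le (inv_pos.2 hspos) hXl
  have hXH : 1 ≤ X₃ * s := by
    calc (1 : ℝ) = s⁻¹ * s := by field_simp
      _ ≤ X₃ * s := mul_le_mul_of_nonneg_right hXl hspos.le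
  have h32 : (H : ℝ) ^ (3 / 2 : ℝ) = H * s := by
    rw [hs, show (3 / 2 : ℝ) = 1 + 1 / 2 by norm_num, Real.rpow_add hHpos, Real.rpow_one]
  have h32pos : 0 < (H : ℝ) ^ (3 / 2 : ℝ) := by positivity
  -- the truncated `X₃' = min X₃ s` and its `δ' = 1/(X₃' H^{3/2}) ∈ [1/H², 1/H]`
  set X₃' : ℝ := min X₃ s with hX₃'
  have hX₃'pos : 0 < X₃' := lt_min hX₃pos hspos
  have hX₃'le : X₃' ≤ X₃ := min_le_left _ _
  have hX₃'s : X₃' ≤ s := min_le_right _ _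
  have hX₃'H : 1 ≤ X₃' * s := by
    rcases le_total X₃ s with h | h
    · rw [hX₃', min_eq_left h]; exact hXH
    · rw [hX₃', min_eq_right h]; nlinarith
  set δ : ℝ := 1 / (X₃ * (H : ℝ) ^ (3 / 2 : ℝ)) with hδ
  set δ' : ℝ := 1 / (X₃' * (H : ℝ) ^ (3 / 2 : ℝ)) with hδ'
  have hδδ' : δ ≤ δ' := by
    rw [hδ, hδ']
    exact one_div_le_one_div_of_le (by positivity) (mul_le_mul_of_nonneg_right hX₃'le h32pos.le)
  have hδ'l : 1 / (H : ℝ) ^ 2 ≤ δ' := by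
    rw [hδ']
    apply one_div_le_one_div_of_le (by positivity)
    calc X₃' * (H : ℝ) ^ (3 / 2 : ℝ) ≤ s * (H : ℝ) ^ (3 / 2 : ℝ) := mul_le_mul_of_nonneg_right hX₃'s h32pos.le
      _ = (H : ℝ) ^ 2 := by rw [h32]; nlinarith [hs2]
  have hδ'u : δ' ≤ 1 / H := by
    rw [hδ']
    apply one_div_le_one_div_of_le hHpos
    calc (H : ℝ) = 1 * H := (one_mul _).symm
      _ ≤ (X₃' * s) * H := mul_le_mul_of_nonneg_right hX₃'H hHpos.le
      _ = X₃' * (H : ℝ) ^ (3 / 2 : ℝ) := by rw [h32]; ring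
  -- (3.10) at `δ'` and monotonicity
  have hA := hCA H hH δ' hδ'l hδ'u
  have hmono : (bourgainFirstSpacingCount H δ (H * δ) : ℝ) ≤ bourgainFirstSpacingCount H δ' (H * δ') := by
    exact_mod_cast bourgainFirstSpacingCount_mono H hδδ' (mul_le_mul_of_nonneg_left hδδ' hHpos.le)
  have hA' : (bourgainFirstSpacingCount H δ (H * δ) : ℝ) ≤ max CA 0 * δ' ^ 2 * (H : ℝ) ^ (10 + 2 * ε) :=
    hmono.trans (hA.trans (mul_le_mul_of_nonneg_right
      (mul_le_mul_of_nonneg_right (le_max_left _ _) (sq_nonneg _)) (by positivity)))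
  -- (3.8) with five coordinates
  have h38 := eq38V5 hH hX₃pos hX₅ hV 𝓘 x hx α hα
  rw [prod_boxFactors5] at h38
  have hprod := prod_bourgainBoxFactors_le hH hX₃pos hXH hV
  -- the key algebra: `X₃² H⁵ δ'² H^{10+2ε} = (X₃/X₃')² H^{12+2ε}` and `X₃/X₃' = max 1 (X₃/s)`
  have hratio : X₃ / X₃' = max 1 (X₃ / s) := by
    rcases le_total X₃ s with h | h
    · rw [hX₃', min_eq_left h, div_self hX₃pos.ne', max_eq_left]
      rw [div_le_one hspos]; exact h
    · rw [hX₃', min_eq_right h, max_eq_right]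
      rw [one_le_div hspos]; exact h
  have h32sq : ((H : ℝ) ^ (3 / 2 : ℝ)) ^ 2 = (H : ℝ) ^ (3 : ℝ) := by
    rw [← Real.rpow_natCast, ← Real.rpow_mul hHpos.le]; norm_num
  have hcancel : X₃ ^ 2 * (H : ℝ) ^ (5 : ℝ) * (δ' ^ 2 * (H : ℝ) ^ (10 + 2 * ε)) =
      (X₃ / X₃') ^ 2 * (H : ℝ) ^ (12 + 2 * ε) := by
    have e1 : X₃ ^ 2 * (H : ℝ) ^ (5 : ℝ) * (δ' ^ 2 * (H : ℝ) ^ (10 + 2 * ε)) =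
        (X₃ / X₃') ^ 2 * ((H : ℝ) ^ (5 : ℝ) * (H : ℝ) ^ (10 + 2 * ε) / ((H : ℝ) ^ (3 / 2 : ℝ)) ^ 2) := by
      rw [hδ']
      field_simp
    rw [e1, h32sq, ← Real.rpow_add hHpos, ← Real.rpow_sub hHpos]
    congr 2
    ring
  have key : (∑ I ∈ 𝓘, ‖hsum5 H α (x I)‖ ^ 6) ^ 2 ≤
      C₀ * (1 + 24 * X₅) * (X₃ / X₃') ^ 2 * (H : ℝ) ^ (12 + 2 * ε) *
        (V * bourgainSecondSpacingCount 𝓘 (fun I => proj4 (x I)) H V) := by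
    have hX5 : 0 ≤ 1 + 24 * X₅ := by positivity
    calc (∑ I ∈ 𝓘, ‖hsum5 H α (x I)‖ ^ 6) ^ 2
        ≤ 624 ^ 5 * ((∏ k, (1 + 2 * bourgainXBound X₃ k * (2 * bourgainYBound H V k))) * (1 + 24 * X₅)) *
            (bourgainSecondSpacingCount 𝓘 (fun I => proj4 (x I)) H V : ℝ) *
            (bourgainFirstSpacingCount H δ (H * δ) : ℝ) := h38
      _ ≤ 624 ^ 5 * ((105625 * V * X₃ ^ 2 * (H : ℝ) ^ (5 : ℝ)) * (1 + 24 * X₅)) *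
            (bourgainSecondSpacingCount 𝓘 (fun I => proj4 (x I)) H V : ℝ) *
            (max CA 0 * δ' ^ 2 * (H : ℝ) ^ (10 + 2 * ε)) := by
          gcongr
      _ = C₀ * (1 + 24 * X₅) * (X₃ ^ 2 * (H : ℝ) ^ (5 : ℝ) * (δ' ^ 2 * (H : ℝ) ^ (10 + 2 * ε))) *
            (V * bourgainSecondSpacingCount 𝓘 (fun I => proj4 (x I)) H V) := by
          rw [hC₀]; ring
      _ = _ := by rw [hcancel]; ring
  have hVB : 0 ≤ V * (bourgainSecondSpacingCount 𝓘 (fun I => proj4 (x I)) H V : ℝ) := by positivity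
  have hH2 : ((H : ℝ) ^ (6 + ε)) ^ 2 = (H : ℝ) ^ (12 + 2 * ε) := by
    rw [← Real.rpow_natCast, ← Real.rpow_mul hHpos.le]
    congr 1
    push_cast
    ring
  have hmax0 : 0 ≤ max 1 (X₃ / s) := le_trans zero_le_one (le_max_left _ _)
  -- take square roots
  have hR : (Real.sqrt C₀ * Real.sqrt (1 + 24 * X₅) * max 1 (X₃ / s) * (H : ℝ) ^ (6 + ε) *
      Real.sqrt (V * bourgainSecondSpacingCount 𝓘 (fun I => proj4 (x I)) H V)) ^ 2 =
      C₀ * (1 + 24 * X₅) * (X₃ / X₃') ^ 2 * (H : ℝ) ^ (12 + 2 * ε) *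
        (V * bourgainSecondSpacingCount 𝓘 (fun I => proj4 (x I)) H V) := by
    rw [hratio]
    have e1 := Real.sq_sqrt hC₀0
    have e2 := Real.sq_sqrt (show (0 : ℝ) ≤ 1 + 24 * X₅ by positivity)
    have e3 := Real.sq_sqrt hVB
    calc _ = (Real.sqrt C₀) ^ 2 * (Real.sqrt (1 + 24 * X₅)) ^ 2 * (max 1 (X₃ / s)) ^ 2 *
          ((H : ℝ) ^ (6 + ε)) ^ 2 *
          (Real.sqrt (V * bourgainSecondSpacingCount 𝓘 (fun I => proj4 (x I)) H V)) ^ 2 := by ring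
      _ = _ := by rw [e1, e2, e3, hH2]
  have hpos : 0 ≤ Real.sqrt C₀ * Real.sqrt (1 + 24 * X₅) * max 1 (X₃ / s) * (H : ℝ) ^ (6 + ε) *
      Real.sqrt (V * bourgainSecondSpacingCount 𝓘 (fun I => proj4 (x I)) H V) := by positivity
  rw [← hR] at key
  exact (pow_le_pow_iff_left₀ (Finset.sum_nonneg fun _ _ => by positivity) hpos two_ne_zero).1 key


/-! ## The `h`-sums over a window `(M₀, H]`: the fifth box size becomes `6(M₀+1)^{-1/2}`

In the application the `h`-sums produced by the Fourier cutoff can be taken over `M₀ < h ≤ H` with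
`M₀ ≍ H₀` (the stationary window starts at `≈ 3H₀`), and then `|y₅(𝐡)| = ∑_j h_j^{-1/2} ≤ 6(M₀+1)^{-1/2}`,
which keeps the fifth box factor `1 + X₅Y₅` bounded on the arcs `q ≍ R`. -/

/-- The five-coordinate `h`-sum over the window `M₀ < h ≤ H`. [folklore] -/
def hsum5From (M₀ H : ℕ) (α : ℂ) (x : Fin 5 → ℝ) : ℂ :=
  ∑ h ∈ Finset.Icc (M₀ + 1) H, α ^ h * e (∑ k, x k * mono5 h k)

/-- Box sizes `(6H, 6H²V, 6H^{3/2}, 6H^{1/2}, 6(M₀+1)^{-1/2})`. [folklore] -/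
def ybound5From (H : ℕ) (V : ℝ) (M₀ : ℕ) : Fin 5 → ℝ :=
  ![6 * (H : ℝ), 6 * (H : ℝ) ^ 2 * V, 6 * (H : ℝ) ^ (3 / 2 : ℝ), 6 * (H : ℝ) ^ (1 / 2 : ℝ),
    6 / Real.sqrt ((M₀ : ℝ) + 1)]

/-- The first four box sizes are Bourgain's. [folklore] -/
theorem ybound5From_castSucc (H : ℕ) (V : ℝ) (M₀ : ℕ) (k : Fin 4) :
    ybound5From H V M₀ (Fin.castSucc k) = bourgainYBound H V k := by
  fin_cases k <;> rfl

/-- `h^{-1/2} ≤ (M₀+1)^{-1/2}` for `h > M₀`. [folklore] -/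
theorem mono5_four_le {h M₀ : ℕ} (hh : M₀ + 1 ≤ h) : mono5 h 4 ≤ 1 / Real.sqrt ((M₀ : ℝ) + 1) := by
  have hR : ((M₀ : ℝ) + 1) ≤ h := by exact_mod_cast hh
  have h0 : (0 : ℝ) < (M₀ : ℝ) + 1 := by positivity
  have hh0 : (0 : ℝ) < h := h0.trans_le hR
  show (h : ℝ) ^ (-(1 / 2) : ℝ) ≤ 1 / Real.sqrt ((M₀ : ℝ) + 1)
  rw [Real.rpow_neg hh0.le, ← Real.sqrt_eq_rpow, ← one_div]
  exact one_div_le_one_div_of_le (Real.sqrt_pos.2 h0) (Real.sqrt_le_sqrt hR)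

/-- The window tuples are among all tuples. [folklore] -/
theorem piFinset_Icc_subset (M₀ H : ℕ) :
    (Fintype.piFinset fun _ : Fin 6 => Finset.Icc (M₀ + 1) H) ⊆
      Fintype.piFinset fun _ : Fin 6 => Finset.Icc 1 H :=
  Fintype.piFinset_subset _ _ fun _ => Finset.Icc_subset_Icc (by omega) le_rfl

/-- `|y_j(𝐡)| ≤ Y_j` on the window, `V = 1`. [folklore] -/
theorem abs_yvec5From_le {H M₀ : ℕ} {w : Fin 6 → ℕ}
    (hw : w ∈ Fintype.piFinset fun _ : Fin 6 => Finset.Icc (M₀ + 1) H) (k : Fin 5) :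
    |yvec5 w k| ≤ ybound5From H 1 M₀ k := by
  induction k using Fin.lastCases with
  | last =>
    show |∑ j, mono5 (w j) 4| ≤ 6 / Real.sqrt ((M₀ : ℝ) + 1)
    have hj : ∀ j, M₀ + 1 ≤ w j := fun j => (Finset.mem_Icc.1 (Fintype.mem_piFinset.1 hw j)).1
    rw [abs_of_nonneg (Finset.sum_nonneg fun j _ => (mono5_four_mem (le_trans (by omega) (hj j))).1)]
    calc ∑ j, mono5 (w j) 4 ≤ ∑ _j : Fin 6, 1 / Real.sqrt ((M₀ : ℝ) + 1) :=
          Finset.sum_le_sum fun j _ => mono5_four_le (hj j)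
      _ = 6 / Real.sqrt ((M₀ : ℝ) + 1) := by simp; ring
  | cast k =>
    rw [ybound5From_castSucc]
    have : yvec5 w (Fin.castSucc k) = bourgainYVec w k := by
      simp only [yvec5, bourgainYVec, mono5_castSucc]
    rw [this]
    exact abs_bourgainYVec_le (piFinset_Icc_subset M₀ H hw) k

/-- `Y_{1,j} ≤ Y_{V,j}`. [folklore] -/
theorem ybound5From_one_le {H : ℕ} {V : ℝ} (hV : 1 ≤ V) (M₀ : ℕ) (k : Fin 5) :
    ybound5From H 1 M₀ k ≤ ybound5From H V M₀ k := by
  induction k using Fin.lastCases with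
  | last => exact le_rfl
  | cast k => rw [ybound5From_castSucc, ybound5From_castSucc]; exact bourgainYBound_one_le hV k

/-- `Y_{V,j} > 0`. [folklore] -/
theorem ybound5From_pos {H : ℕ} (hH : 1 ≤ H) {V : ℝ} (hV : 0 < V) (M₀ : ℕ) (k : Fin 5) :
    0 < ybound5From H V M₀ k := by
  induction k using Fin.lastCases with
  | last =>
    show (0 : ℝ) < 6 / Real.sqrt ((M₀ : ℝ) + 1)
    have : 0 < Real.sqrt ((M₀ : ℝ) + 1) := Real.sqrt_pos.2 (by positivity)
    positivity
  | cast k => rw [ybound5From_castSucc]; exact bourgainYBound_pos hH hV k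

/-- Expansion of the sixth power over six-tuples of the window. [folklore] -/
theorem hsum5From_pow_six (M₀ H : ℕ) (α : ℂ) (x : Fin 5 → ℝ) :
    hsum5From M₀ H α x ^ 6 =
      ∑ w ∈ Fintype.piFinset (fun _ : Fin 6 => Finset.Icc (M₀ + 1) H),
        α ^ (∑ j, w j) * e (∑ k, x k * yvec5 w k) := by
  unfold hsum5From
  have h6 : (∑ h ∈ Finset.Icc (M₀ + 1) H, α ^ h * e (∑ k, x k * mono5 h k)) ^ 6 =
      ∏ _j : Fin 6, ∑ h ∈ Finset.Icc (M₀ + 1) H, α ^ h * e (∑ k, x k * mono5 h k) := by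
    rw [Finset.prod_const, Finset.card_univ, Fintype.card_fin]
  rw [h6, Finset.prod_univ_sum (fun _ : Fin 6 => Finset.Icc (M₀ + 1) H)
    (fun _ h => α ^ h * e (∑ k, x k * mono5 h k))]
  refine Finset.sum_congr rfl fun w _ => ?_
  rw [Finset.prod_mul_distrib, Finset.prod_pow_eq_pow_sum, ← e_sum]
  have hsum : ∑ j, ∑ k, x k * mono5 (w j) k = ∑ k, x k * yvec5 w k := by
    rw [Finset.sum_comm]
    simp only [yvec5, Finset.mul_sum]
  rw [hsum]

/-- The neighbour count is monotone in the set. [folklore] -/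
theorem closePairs_mono_set {ι β : Type*} [Fintype ι] [DecidableEq β] {s t : Finset β} (hst : s ⊆ t)
    (y : β → ι → ℝ) (δ : ι → ℝ) : closePairs s y δ ≤ closePairs t y δ := by
  unfold DoubleLargeSieve.closePairs
  refine Finset.card_le_card fun p hp => ?_
  have hp' := (@Finset.mem_filter _ _ (_) _ _).1 hp
  exact (@Finset.mem_filter _ _ (_) _ _).2 ⟨Finset.product_subset_product hst hst hp'.1, hp'.2⟩

/-- Dropping the fifth condition on the second spacing side, window version. [folklore] -/
theorem closePairs5From_le_secondSpacingCount (𝓘 : Finset ℕ) (x : ℕ → Fin 5 → ℝ) {H : ℕ} (hH : 1 ≤ H)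
    {V : ℝ} (hV : 0 < V) (M₀ : ℕ) :
    closePairs 𝓘 x (fun k => (2 * (2 * ybound5From H V M₀ k))⁻¹) ≤
      bourgainSecondSpacingCount 𝓘 (fun I => proj4 (x I)) H V := by
  unfold bourgainSecondSpacingCount
  refine closePairs_le_card_filter 𝓘 x _ _ fun p _ hp k => ?_
  have h := hp (Fin.castSucc k)
  rw [ybound5From_castSucc] at h
  have hY := bourgainYBound_pos hH hV k
  refine lt_of_le_of_lt h ?_
  rw [inv_lt_inv₀ (by positivity) (by positivity)]
  linarith

/-- **Double large sieve for the five-coordinate family on the window `(M₀, H]`.**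
[cite: BourgainJAMS2017, §4 eqs. (3.7)–(3.9)] [cite: BombieriIwaniec1986, Lemma 2.4] -/
theorem eq38V5From {H : ℕ} (hH : 1 ≤ H) (M₀ : ℕ) {X₃ X₅ : ℝ} (hX₃ : 0 < X₃) (hX₅ : 0 < X₅) {V : ℝ} (hV : 1 ≤ V)
    (𝓘 : Finset ℕ) (x : ℕ → Fin 5 → ℝ) (hx : ∀ I ∈ 𝓘, ∀ k, |x I k| ≤ xbound5 X₃ X₅ k)
    (α : ℂ) (hα : ‖α‖ ≤ 1) :
    (∑ I ∈ 𝓘, ‖hsum5From M₀ H α (x I)‖ ^ 6) ^ 2 ≤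
      624 ^ 5 * (∏ k, (1 + 2 * xbound5 X₃ X₅ k * (2 * ybound5From H V M₀ k))) *
        (bourgainSecondSpacingCount 𝓘 (fun I => proj4 (x I)) H V : ℝ) *
        (bourgainFirstSpacingCount H (1 / (X₃ * (H : ℝ) ^ (3 / 2 : ℝ)))
          (H * (1 / (X₃ * (H : ℝ) ^ (3 / 2 : ℝ)))) : ℝ) := by
  classical
  set sY := Fintype.piFinset fun _ : Fin 6 => Finset.Icc (M₀ + 1) H with hsY
  set b : (Fin 6 → ℕ) → ℂ := fun w => α ^ (∑ j, w j) with hb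
  set X' : Fin 5 → ℝ := fun k => 2 * xbound5 X₃ X₅ k with hX'
  set Y' : Fin 5 → ℝ := fun k => 2 * ybound5From H V M₀ k with hY'
  have hV0 : 0 < V := by linarith
  obtain ⟨ω, hω, hsum⟩ := exists_unimodular_sum_norm_eq 𝓘 (fun I => hsum5From M₀ H α (x I) ^ 6)
  have hbil : (((∑ I ∈ 𝓘, ‖hsum5From M₀ H α (x I)‖ ^ 6 : ℝ)) : ℂ) =
      ∑ I ∈ 𝓘, ∑ w ∈ sY, ω I * b w * e (∑ k, x I k * yvec5 w k) := by
    have h1 : (∑ I ∈ 𝓘, ‖hsum5From M₀ H α (x I)‖ ^ 6) = ∑ I ∈ 𝓘, ‖hsum5From M₀ H α (x I) ^ 6‖ := by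
      simp_rw [norm_pow]
    rw [h1, hsum]
    refine Finset.sum_congr rfl fun I _ => ?_
    rw [hsum5From_pow_six, Finset.mul_sum]
    refine Finset.sum_congr rfl fun w _ => ?_
    simp only [hb]
    ring
  have hXpos : ∀ k, 0 < X' k := fun k => mul_pos two_pos (xbound5_pos hX₃ hX₅ k)
  have hYpos : ∀ k, 0 < Y' k := fun k => mul_pos two_pos (ybound5From_pos hH hV0 M₀ k)
  have hx' : ∀ I ∈ 𝓘, ∀ k, |x I k| ≤ X' k := fun I hI k =>
    (hx I hI k).trans (by simp only [hX']; linarith [xbound5_pos hX₃ hX₅ k])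
  have hy' : ∀ w ∈ sY, ∀ k, |yvec5 w k| ≤ Y' k := fun w hw k =>
    ((abs_yvec5From_le hw k).trans (ybound5From_one_le hV M₀ k)).trans
      (by simp only [hY']; linarith [ybound5From_pos hH hV0 M₀ k])
  have hbn : ∀ w ∈ sY, ‖b w‖ ≤ 1 := fun w _ => by
    simp only [hb, norm_pow]
    exact pow_le_one₀ (norm_nonneg _) hα
  have hDLS := doubleLargeSieve_count 𝓘 sY x yvec5 ω b X' Y' hXpos hYpos hx' hy' (fun I _ => hω I) hbn
  have hL : ‖∑ I ∈ 𝓘, ∑ w ∈ sY, ω I * b w * e (∑ k, x I k * yvec5 w k)‖ ^ 2 =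
      (∑ I ∈ 𝓘, ‖hsum5From M₀ H α (x I)‖ ^ 6) ^ 2 := by
    rw [← hbil, Complex.norm_real, Real.norm_eq_abs,
      abs_of_nonneg (Finset.sum_nonneg fun _ _ => by positivity)]
  rw [hL, Fintype.card_fin] at hDLS
  refine hDLS.trans ?_
  have hB : (closePairs 𝓘 x (fun k => (2 * Y' k)⁻¹) : ℝ) ≤
      bourgainSecondSpacingCount 𝓘 (fun I => proj4 (x I)) H V := by
    exact_mod_cast closePairs5From_le_secondSpacingCount 𝓘 x hH hV0 M₀
  have hA : (closePairs sY yvec5 (fun k => (2 * X' k)⁻¹) : ℝ) ≤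
      bourgainFirstSpacingCount H (1 / (X₃ * (H : ℝ) ^ (3 / 2 : ℝ)))
        (H * (1 / (X₃ * (H : ℝ) ^ (3 / 2 : ℝ)))) := by
    have h1 := closePairs_mono_set (piFinset_Icc_subset M₀ H) yvec5 (fun k => (2 * X' k)⁻¹)
    have h2 := closePairs5_le_firstSpacingCount hH X₅ hX₃
    exact_mod_cast h1.trans h2
  have h0 : (0 : ℝ) ≤ 624 ^ 5 * ∏ k, (1 + X' k * Y' k) :=
    mul_nonneg (by positivity) (Finset.prod_nonneg fun k _ => by nlinarith [hXpos k, hYpos k])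
  have hprod : ∏ k, (1 + X' k * Y' k) = ∏ k, (1 + 2 * xbound5 X₃ X₅ k * (2 * ybound5From H V M₀ k)) :=
    Finset.prod_congr rfl fun k _ => by simp only [hX', hY']
  calc (624 : ℝ) ^ 5 * (∏ k, (1 + X' k * Y' k)) *
        (closePairs 𝓘 x (fun k => (2 * Y' k)⁻¹) : ℝ) * (closePairs sY yvec5 (fun k => (2 * X' k)⁻¹) : ℝ)
      ≤ 624 ^ 5 * (∏ k, (1 + X' k * Y' k)) *
          (bourgainSecondSpacingCount 𝓘 (fun I => proj4 (x I)) H V : ℝ) *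
          (closePairs sY yvec5 (fun k => (2 * X' k)⁻¹) : ℝ) :=
        mul_le_mul_of_nonneg_right (mul_le_mul_of_nonneg_left hB h0) (Nat.cast_nonneg _)
    _ ≤ 624 ^ 5 * (∏ k, (1 + X' k * Y' k)) *
          (bourgainSecondSpacingCount 𝓘 (fun I => proj4 (x I)) H V : ℝ) *
          (bourgainFirstSpacingCount H (1 / (X₃ * (H : ℝ) ^ (3 / 2 : ℝ)))
            (H * (1 / (X₃ * (H : ℝ) ^ (3 / 2 : ℝ)))) : ℝ) :=
        mul_le_mul_of_nonneg_left hA (mul_nonneg h0 (Nat.cast_nonneg _))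
    _ = _ := by rw [hprod]

/-- The five box factors on the window: Bourgain's four times `1 + 24X₅(M₀+1)^{-1/2}`. [folklore] -/
theorem prod_boxFactors5From (H : ℕ) (X₃ X₅ V : ℝ) (M₀ : ℕ) :
    ∏ k, (1 + 2 * xbound5 X₃ X₅ k * (2 * ybound5From H V M₀ k)) =
      (∏ k, (1 + 2 * bourgainXBound X₃ k * (2 * bourgainYBound H V k))) *
        (1 + 24 * X₅ / Real.sqrt ((M₀ : ℝ) + 1)) := by
  rw [Fin.prod_univ_castSucc]
  have h1 : ∏ i : Fin 4, (1 + 2 * xbound5 X₃ X₅ (Fin.castSucc i) * (2 * ybound5From H V M₀ (Fin.castSucc i))) =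
      ∏ k, (1 + 2 * bourgainXBound X₃ k * (2 * bourgainYBound H V k)) :=
    Finset.prod_congr rfl fun k _ => by rw [xbound5_castSucc, ybound5From_castSucc]
  have h2 : (1 + 2 * xbound5 X₃ X₅ (Fin.last 4) * (2 * ybound5From H V M₀ (Fin.last 4))) =
      1 + 24 * X₅ / Real.sqrt ((M₀ : ℝ) + 1) := by
    show 1 + 2 * X₅ * (2 * (6 / Real.sqrt ((M₀ : ℝ) + 1))) = 1 + 24 * X₅ / Real.sqrt ((M₀ : ℝ) + 1); ring
  rw [h1, h2]

/-- **Sixth moment of the five-coordinate `h`-sums on a window `(M₀, H]` from Corollary 3**: as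
`sixthMoment5_of_corollary3` with the fifth box factor `(1 + 24X₅(M₀+1)^{-1/2})^{1/2}`.
[cite: BourgainJAMS2017, §4 eqs. (3.8), (3.10), (3.14)] -/
theorem sixthMoment5From_of_corollary3
    (hC3 : ∀ ε : ℝ, 0 < ε → ∃ C : ℝ, ∀ N : ℕ, 1 ≤ N → ∀ δ Δ : ℝ,
      1 / (N : ℝ) ^ 2 ≤ δ → δ ≤ 1 → 1 / (N : ℝ) ≤ Δ → Δ ≤ 1 →
        bourgainA6 N δ Δ ≤ C * δ * Δ * (N : ℝ) ^ (9 + ε))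
    {ε : ℝ} (hε : 0 < ε) :
    ∃ C : ℝ, ∀ H : ℕ, 1 ≤ H → ∀ M₀ : ℕ, ∀ X₃ : ℝ, (H : ℝ) ^ (-(1 / 2 : ℝ)) ≤ X₃ → ∀ X₅ : ℝ, 0 < X₅ →
      ∀ V : ℝ, 1 ≤ V → ∀ (𝓘 : Finset ℕ) (x : ℕ → Fin 5 → ℝ),
        (∀ I ∈ 𝓘, ∀ k, |x I k| ≤ xbound5 X₃ X₅ k) → ∀ α : ℂ, ‖α‖ ≤ 1 →
          ∑ I ∈ 𝓘, ‖hsum5From M₀ H α (x I)‖ ^ 6 ≤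
            C * Real.sqrt (1 + 24 * X₅ / Real.sqrt ((M₀ : ℝ) + 1)) * max 1 (X₃ / (H : ℝ) ^ (1 / 2 : ℝ)) *
              (H : ℝ) ^ (6 + ε) *
              Real.sqrt (V * bourgainSecondSpacingCount 𝓘 (fun I => proj4 (x I)) H V) := by
  obtain ⟨CA, hCA⟩ := Bourgain2017_eq310_count_of_corollary3 hC3 (show 0 < 2 * ε by linarith)
  set C₀ : ℝ := 624 ^ 5 * 105625 * max CA 0 with hC₀
  have hC₀0 : 0 ≤ C₀ := by positivity
  refine ⟨Real.sqrt C₀, ?_⟩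
  intro H hH M₀ X₃ hXl X₅ hX₅ V hV 𝓘 x hx α hα
  have hHpos : (0 : ℝ) < H := by exact_mod_cast hH
  have hH1 : (1 : ℝ) ≤ H := by exact_mod_cast hH
  have hV0 : 0 < V := by linarith
  set s : ℝ := (H : ℝ) ^ (1 / 2 : ℝ) with hs
  have hspos : 0 < s := by positivity
  have hs2 : s ^ 2 = H := by
    rw [hs, ← Real.rpow_natCast, ← Real.rpow_mul hHpos.le]; norm_num
  have hm12 : (H : ℝ) ^ (-(1 / 2 : ℝ)) = s⁻¹ := Real.rpow_neg hHpos.le _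
  rw [hm12] at hXl
  have hX₃pos : 0 < X₃ := lt_of_lt_of_le (inv_pos.2 hspos) hXl
  have hXH : 1 ≤ X₃ * s := by
    calc (1 : ℝ) = s⁻¹ * s := by field_simp
      _ ≤ X₃ * s := mul_le_mul_of_nonneg_right hXl hspos.le
  have h32 : (H : ℝ) ^ (3 / 2 : ℝ) = H * s := by
    rw [hs, show (3 / 2 : ℝ) = 1 + 1 / 2 by norm_num, Real.rpow_add hHpos, Real.rpow_one]
  have h32pos : 0 < (H : ℝ) ^ (3 / 2 : ℝ) := by positivity
  set X₃' : ℝ := min X₃ s with hX₃'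
  have hX₃'pos : 0 < X₃' := lt_min hX₃pos hspos
  have hX₃'le : X₃' ≤ X₃ := min_le_left _ _
  have hX₃'s : X₃' ≤ s := min_le_right _ _
  have hX₃'H : 1 ≤ X₃' * s := by
    rcases le_total X₃ s with h | h
    · rw [hX₃', min_eq_left h]; exact hXH
    · rw [hX₃', min_eq_right h]; nlinarith
  set δ : ℝ := 1 / (X₃ * (H : ℝ) ^ (3 / 2 : ℝ)) with hδ
  set δ' : ℝ := 1 / (X₃' * (H : ℝ) ^ (3 / 2 : ℝ)) with hδ'
  have hδδ' : δ ≤ δ' := by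
    rw [hδ, hδ']
    exact one_div_le_one_div_of_le (by positivity) (mul_le_mul_of_nonneg_right hX₃'le h32pos.le)
  have hδ'l : 1 / (H : ℝ) ^ 2 ≤ δ' := by
    rw [hδ']
    apply one_div_le_one_div_of_le (by positivity)
    calc X₃' * (H : ℝ) ^ (3 / 2 : ℝ) ≤ s * (H : ℝ) ^ (3 / 2 : ℝ) := mul_le_mul_of_nonneg_right hX₃'s h32pos.le
      _ = (H : ℝ) ^ 2 := by rw [h32]; nlinarith [hs2]
  have hδ'u : δ' ≤ 1 / H := by
    rw [hδ']
    apply one_div_le_one_div_of_le hHpos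
    calc (H : ℝ) = 1 * H := (one_mul _).symm
      _ ≤ (X₃' * s) * H := mul_le_mul_of_nonneg_right hX₃'H hHpos.le
      _ = X₃' * (H : ℝ) ^ (3 / 2 : ℝ) := by rw [h32]; ring
  have hA := hCA H hH δ' hδ'l hδ'u
  have hmono : (bourgainFirstSpacingCount H δ (H * δ) : ℝ) ≤ bourgainFirstSpacingCount H δ' (H * δ') := by
    exact_mod_cast bourgainFirstSpacingCount_mono H hδδ' (mul_le_mul_of_nonneg_left hδδ' hHpos.le)
  have hA' : (bourgainFirstSpacingCount H δ (H * δ) : ℝ) ≤ max CA 0 * δ' ^ 2 * (H : ℝ) ^ (10 + 2 * ε) :=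
    hmono.trans (hA.trans (mul_le_mul_of_nonneg_right
      (mul_le_mul_of_nonneg_right (le_max_left _ _) (sq_nonneg _)) (by positivity)))
  have h38 := eq38V5From hH M₀ hX₃pos hX₅ hV 𝓘 x hx α hα
  rw [prod_boxFactors5From] at h38
  have hprod := prod_bourgainBoxFactors_le hH hX₃pos hXH hV
  have hratio : X₃ / X₃' = max 1 (X₃ / s) := by
    rcases le_total X₃ s with h | h
    · rw [hX₃', min_eq_left h, div_self hX₃pos.ne', max_eq_left]
      rw [div_le_one hspos]; exact h
    · rw [hX₃', min_eq_right h, max_eq_right]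
      rw [one_le_div hspos]; exact h
  have h32sq : ((H : ℝ) ^ (3 / 2 : ℝ)) ^ 2 = (H : ℝ) ^ (3 : ℝ) := by
    rw [← Real.rpow_natCast, ← Real.rpow_mul hHpos.le]; norm_num
  have hcancel : X₃ ^ 2 * (H : ℝ) ^ (5 : ℝ) * (δ' ^ 2 * (H : ℝ) ^ (10 + 2 * ε)) =
      (X₃ / X₃') ^ 2 * (H : ℝ) ^ (12 + 2 * ε) := by
    have e1 : X₃ ^ 2 * (H : ℝ) ^ (5 : ℝ) * (δ' ^ 2 * (H : ℝ) ^ (10 + 2 * ε)) =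
        (X₃ / X₃') ^ 2 * ((H : ℝ) ^ (5 : ℝ) * (H : ℝ) ^ (10 + 2 * ε) / ((H : ℝ) ^ (3 / 2 : ℝ)) ^ 2) := by
      rw [hδ']
      field_simp
    rw [e1, h32sq, ← Real.rpow_add hHpos, ← Real.rpow_sub hHpos]
    congr 2
    ring
  set F : ℝ := 1 + 24 * X₅ / Real.sqrt ((M₀ : ℝ) + 1) with hF
  have hF0 : 0 ≤ F := by
    rw [hF]
    have : 0 < Real.sqrt ((M₀ : ℝ) + 1) := Real.sqrt_pos.2 (by positivity)
    positivity
  have key : (∑ I ∈ 𝓘, ‖hsum5From M₀ H α (x I)‖ ^ 6) ^ 2 ≤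
      C₀ * F * (X₃ / X₃') ^ 2 * (H : ℝ) ^ (12 + 2 * ε) *
        (V * bourgainSecondSpacingCount 𝓘 (fun I => proj4 (x I)) H V) := by
    calc (∑ I ∈ 𝓘, ‖hsum5From M₀ H α (x I)‖ ^ 6) ^ 2
        ≤ 624 ^ 5 * ((∏ k, (1 + 2 * bourgainXBound X₃ k * (2 * bourgainYBound H V k))) * F) *
            (bourgainSecondSpacingCount 𝓘 (fun I => proj4 (x I)) H V : ℝ) *
            (bourgainFirstSpacingCount H δ (H * δ) : ℝ) := h38
      _ ≤ 624 ^ 5 * ((105625 * V * X₃ ^ 2 * (H : ℝ) ^ (5 : ℝ)) * F) *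
            (bourgainSecondSpacingCount 𝓘 (fun I => proj4 (x I)) H V : ℝ) *
            (max CA 0 * δ' ^ 2 * (H : ℝ) ^ (10 + 2 * ε)) := by
          gcongr
      _ = C₀ * F * (X₃ ^ 2 * (H : ℝ) ^ (5 : ℝ) * (δ' ^ 2 * (H : ℝ) ^ (10 + 2 * ε))) *
            (V * bourgainSecondSpacingCount 𝓘 (fun I => proj4 (x I)) H V) := by
          rw [hC₀]; ring
      _ = _ := by rw [hcancel]; ring
  have hVB : 0 ≤ V * (bourgainSecondSpacingCount 𝓘 (fun I => proj4 (x I)) H V : ℝ) := by positivity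
  have hH2 : ((H : ℝ) ^ (6 + ε)) ^ 2 = (H : ℝ) ^ (12 + 2 * ε) := by
    rw [← Real.rpow_natCast, ← Real.rpow_mul hHpos.le]
    congr 1
    push_cast
    ring
  have hmax0 : 0 ≤ max 1 (X₃ / s) := le_trans zero_le_one (le_max_left _ _)
  have hR : (Real.sqrt C₀ * Real.sqrt F * max 1 (X₃ / s) * (H : ℝ) ^ (6 + ε) *
      Real.sqrt (V * bourgainSecondSpacingCount 𝓘 (fun I => proj4 (x I)) H V)) ^ 2 =
      C₀ * F * (X₃ / X₃') ^ 2 * (H : ℝ) ^ (12 + 2 * ε) *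
        (V * bourgainSecondSpacingCount 𝓘 (fun I => proj4 (x I)) H V) := by
    rw [hratio]
    have e1 := Real.sq_sqrt hC₀0
    have e2 := Real.sq_sqrt hF0
    have e3 := Real.sq_sqrt hVB
    calc _ = (Real.sqrt C₀) ^ 2 * (Real.sqrt F) ^ 2 * (max 1 (X₃ / s)) ^ 2 *
          ((H : ℝ) ^ (6 + ε)) ^ 2 *
          (Real.sqrt (V * bourgainSecondSpacingCount 𝓘 (fun I => proj4 (x I)) H V)) ^ 2 := by ring
      _ = _ := by rw [e1, e2, e3, hH2]
  have hpos : 0 ≤ Real.sqrt C₀ * Real.sqrt F * max 1 (X₃ / s) * (H : ℝ) ^ (6 + ε) *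
      Real.sqrt (V * bourgainSecondSpacingCount 𝓘 (fun I => proj4 (x I)) H V) := by positivity
  rw [← hR] at key
  exact (pow_le_pow_iff_left₀ (Finset.sum_nonneg fun _ _ => by positivity) hpos two_ne_zero).1 key

end Literature.NumberTheory.LFunctions
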